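import Summits.Ventures.PercRepro.ProfilePointedCircuitClassesStarSharpD1
import Summits.Ventures.PercRepro.ProfilePointedCircuitClassesStarSharpZ

/-! # The parallel-twin-of-`e` regime (D1) of `StarNineSharp`: the dictionary, II — the three counts
(p5 g53, §80 ADD 9(c)).  Continues ProfilePointedCircuitClassesStarSharpD1: the injections (A) Type II → OFF Type I
and (B) OFF Type I → Type II, and the six-point count (C) of the ON Type I sets. -/

open scoped Matroid

namespace PercRepro.Cogirth

open Finset ThmH Skew Shadow Profile

variable {α : Type} [DecidableEq α] {N : Matroid α} [N.Finite]

section StarSharpD2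

/-- Peeling `b, f, e` off `insert b (insert f (insert e S))` when they are not in `S`. -/
theorem erase_erase_erase_insert_eq {b f e : α} {S : Finset α} (hb : b ∉ S) (hf : f ∉ S) (he : e ∉ S)
    (hbf : b ≠ f) (hbe : b ≠ e) (hfe : f ≠ e) :
    (((insert b (insert f (insert e S))).erase b).erase f).erase e = S := by
  rw [erase_insert (by simp only [mem_insert, not_or]; exact ⟨hbf, hbe, hb⟩),
    erase_insert (by simp only [mem_insert, not_or]; exact ⟨hfe, hf⟩), erase_insert he]

/-- `b, f, e ∉ Q ∖ W`. -/
theorem not_mem_Q_sdiff {b b' e x f : α} {W : Finset α} :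
    b ∉ (((((gr N).erase b).erase b').erase e).erase x).erase f \ W ∧
      f ∉ (((((gr N).erase b).erase b').erase e).erase x).erase f \ W ∧
      e ∉ (((((gr N).erase b).erase b').erase e).erase x).erase f \ W ∧
      b' ∉ (((((gr N).erase b).erase b').erase e).erase x).erase f \ W := by
  refine ⟨fun h' => ?_, fun h' => ?_, fun h' => ?_, fun h' => ?_⟩
  · exact (mem_erase.1 (mem_erase.1 (mem_Q_unpack (mem_sdiff.1 h').1).2.2.2).2).1 rfl
  · exact (mem_Q_unpack (mem_sdiff.1 h').1).1 rfl
  · exact (mem_Q_unpack (mem_sdiff.1 h').1).2.2.1 rfl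
  · exact (mem_erase.1 (mem_Q_unpack (mem_sdiff.1 h').1).2.2.2).1 rfl

/-- **(A)**: `#(Type II sets of the left family) ≤ #(OFF Type I sets of the right family)`. -/
theorem card_typeII_le_card_typeI_off {b b' e x f : α} (h : SeriesPair N b b') (hn : (gr N).card = 9)
    (he : e ∈ ((gr N).erase b).erase b') (hx : x ∈ ((gr N).erase b).erase b') (hf : f ∈ ((gr N).erase b).erase b')
    (hxe : x ≠ e) (hfe : f ≠ e) (hfx : f ≠ x) (he1 : rk N {e} = 1) (hx1 : rk N {x} = 1) (hex : rk N {e, x} = 1) :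
    ((biIndepSets N 4).filter (fun W => ((e ∈ W ∧ f ∉ W) ∧ b' ∉ W) ∧ b ∉ W)).card ≤
      ((biIndepSets N 4).filter (fun W => (((e ∈ W ∧ f ∈ W) ∧ b' ∉ W) ∧ b ∈ W) ∧ ¬ rk N (insert b' W) ≤ 4)).card := by
  have hbf : b ≠ f := fun h' => (mem_erase.1 (mem_erase.1 hf).2).1 h'.symm
  have hbe : b ≠ e := fun h' => (mem_erase.1 (mem_erase.1 he).2).1 h'.symm
  have hb'f : b' ≠ f := fun h' => (mem_erase.1 hf).1 h'.symm
  have hb'e : b' ≠ e := fun h' => (mem_erase.1 he).1 h'.symm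
  have hbb' : b ≠ b' := h.2.2.1
  apply card_le_card_of_injOn
    (fun W => insert b (insert f (insert e ((((((gr N).erase b).erase b').erase e).erase x).erase f \ W))))
  · intro W hW
    simp only [mem_coe, mem_filter] at hW ⊢
    obtain ⟨hW, ⟨⟨heW, hfW⟩, hb'W⟩, hbW⟩ := hW
    obtain ⟨hmem, hoff⟩ := typeII_image_mem h hn he hx hf hxe hfe hfx he1 hx1 hex hW heW hfW hb'W hbW
    obtain ⟨-, -, -, hb'Q⟩ := not_mem_Q_sdiff (N := N) (b := b) (b' := b') (e := e) (x := x) (f := f) (W := W)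
    refine ⟨hmem, ⟨⟨⟨mem_insert_of_mem (mem_insert_of_mem (mem_insert_self e _)),
      mem_insert_of_mem (mem_insert_self f _)⟩, ?_⟩, mem_insert_self b _⟩, hoff⟩
    simp only [mem_insert, not_or]
    exact ⟨hbb'.symm, hb'f, hb'e, hb'Q⟩
  · intro W₁ hW₁ W₂ hW₂ heq
    simp only [mem_coe, mem_filter] at hW₁ hW₂
    obtain ⟨hW₁, ⟨⟨heW₁, hfW₁⟩, hb'W₁⟩, hbW₁⟩ := hW₁
    obtain ⟨hW₂, ⟨⟨heW₂, hfW₂⟩, hb'W₂⟩, hbW₂⟩ := hW₂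
    obtain ⟨hbQ₁, hfQ₁, heQ₁, -⟩ := not_mem_Q_sdiff (N := N) (b := b) (b' := b') (e := e) (x := x) (f := f) (W := W₁)
    obtain ⟨hbQ₂, hfQ₂, heQ₂, -⟩ := not_mem_Q_sdiff (N := N) (b := b) (b' := b') (e := e) (x := x) (f := f) (W := W₂)
    have hsd : (((((gr N).erase b).erase b').erase e).erase x).erase f \ W₁ =
        (((((gr N).erase b).erase b').erase e).erase x).erase f \ W₂ := by
      have := congrArg (fun S => ((S.erase b).erase f).erase e) heq
      simp only at this
      rwa [erase_erase_erase_insert_eq hbQ₁ hfQ₁ heQ₁ hbf hbe hfe,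
        erase_erase_erase_insert_eq hbQ₂ hfQ₂ heQ₂ hbf hbe hfe] at this
    obtain ⟨-, -, u₁, -, hQW₁, hQ₁⟩ := typeII_structure h hn he hx hf hxe hfe hfx hex hW₁ heW₁ hfW₁ hb'W₁ hbW₁
    obtain ⟨-, -, u₂, -, hQW₂, hQ₂⟩ := typeII_structure h hn he hx hf hxe hfe hfx hex hW₂ heW₂ hfW₂ hb'W₂ hbW₂
    have hu : u₁ = u₂ := by
      have : ({u₁} : Finset α) = {u₂} := by rw [← hQW₁, ← hQW₂, hsd]
      exact singleton_injective this
    subst hu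
    have huW₁ : u₁ ∉ W₁.erase e := fun h' => (mem_sdiff.1 (hQW₁ ▸ mem_singleton_self u₁)).2 (mem_of_mem_erase h')
    have huW₂ : u₁ ∉ W₂.erase e := fun h' => (mem_sdiff.1 (hQW₂ ▸ mem_singleton_self u₁)).2 (mem_of_mem_erase h')
    have hτ : W₁.erase e = W₂.erase e := by
      have := hQ₁.symm.trans hQ₂
      rw [← erase_insert huW₁, ← erase_insert huW₂, this]
    rw [← insert_erase heW₁, ← insert_erase heW₂, hτ]

/-- `Q ∖ insert b {e, u, v} = (Q − u) − v` (`b, e ∉ Q`). -/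
theorem Q_sdiff_typeI_eq {b b' e x f u v : α} :
    (((((gr N).erase b).erase b').erase e).erase x).erase f \ insert b {e, u, v} =
      (((((((gr N).erase b).erase b').erase e).erase x).erase f).erase u).erase v := by
  set Q := (((((gr N).erase b).erase b').erase e).erase x).erase f with hQ
  ext z
  simp only [mem_sdiff, mem_insert, mem_singleton, not_or]
  constructor
  · rintro ⟨hz, -, -, hzu, hzv⟩
    exact mem_erase.2 ⟨hzv, mem_erase.2 ⟨hzu, hz⟩⟩
  · intro hz
    have hz' := mem_of_mem_erase (mem_of_mem_erase hz)
    exact ⟨hz', fun h' => (mem_erase.1 (mem_erase.1 (mem_Q_unpack hz').2.2.2).2).1 h',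
      (mem_Q_unpack hz').2.2.1, (mem_erase.1 (mem_erase.1 hz).2).1, (mem_erase.1 hz).1⟩

/-- For `u ≠ v ∈ Q`: `E₇ ∖ (insert f (insert e ((Q − u) − v))) = {x, u, v}`. -/
theorem E7_sdiff_typeII_image_eq {b b' e x f u v : α} (hx : x ∈ ((gr N).erase b).erase b')
    (hxe : x ≠ e) (hfx : f ≠ x)
    (hu : u ∈ (((((gr N).erase b).erase b').erase e).erase x).erase f)
    (hv : v ∈ (((((gr N).erase b).erase b').erase e).erase x).erase f) :
    ((gr N).erase b).erase b' \ insert f (insert e ((((((((gr N).erase b).erase b').erase e).erase x).erase f).erase u).erase v))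
      = {x, u, v} := by
  obtain ⟨huf, hux, hue, huE⟩ := mem_Q_unpack hu
  obtain ⟨hvf, hvx, hve, hvE⟩ := mem_Q_unpack hv
  set Q := (((((gr N).erase b).erase b').erase e).erase x).erase f with hQ
  set E7 := ((gr N).erase b).erase b' with hE7
  ext z
  simp only [mem_sdiff, mem_insert, mem_singleton, not_or]
  constructor
  · rintro ⟨hzE, hzf, hze, hz⟩
    by_cases hzx : z = x
    · exact Or.inl hzx
    · by_cases hzu : z = u
      · exact Or.inr (Or.inl hzu)
      · by_cases hzv : z = v
        · exact Or.inr (Or.inr hzv)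
        · exact absurd (mem_erase.2 ⟨hzv, mem_erase.2 ⟨hzu, mem_Q_pack hzf hzx hze hzE⟩⟩) hz
  · rintro (rfl | rfl | rfl)
    · exact ⟨hx, fun h' => hfx h'.symm, hxe,
        fun h' => (mem_Q_unpack (mem_of_mem_erase (mem_of_mem_erase h'))).2.1 rfl⟩
    · exact ⟨huE, huf, hue, fun h' => (mem_erase.1 (mem_erase.1 h').2).1 rfl⟩
    · exact ⟨hvE, hvf, hve, fun h' => (mem_erase.1 h').1 rfl⟩

/-- **(B), image**: an OFF Type I set `W = insert b {e, u, v}` of the left family goes to the Type II set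
`insert f (insert e (Q ∖ W))` of the right family. -/
theorem typeI_off_image_mem {b b' e x f : α} (h : SeriesPair N b b') (hn : (gr N).card = 9)
    (he : e ∈ ((gr N).erase b).erase b') (hx : x ∈ ((gr N).erase b).erase b') (hf : f ∈ ((gr N).erase b).erase b')
    (hxe : x ≠ e) (hfe : f ≠ e) (hfx : f ≠ x) (he1 : rk N {e} = 1) (hx1 : rk N {x} = 1) (hex : rk N {e, x} = 1)
    {W : Finset α} (hW : W ∈ biIndepSets N 4) (heW : e ∈ W) (hfW : f ∉ W) (hb'W : b' ∉ W) (hbW : b ∈ W)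
    (hoff : ¬ rk N (insert b' W) ≤ 4) :
    insert f (insert e ((((((gr N).erase b).erase b').erase e).erase x).erase f \ W)) ∈ biIndepSets N 4 := by
  obtain ⟨u, v, hu, hv, huv, hWuv⟩ := typeI_structure h he hxe hex hW heW hfW hb'W hbW
  obtain ⟨huf, hux, hue, huE⟩ := mem_Q_unpack hu
  obtain ⟨hvf, hvx, hve, hvE⟩ := mem_Q_unpack hv
  have hbg : b ∈ gr N := h.1
  have hb'g : b' ∈ gr N := h.2.1
  have hxg : x ∈ gr N := mem_of_mem_erase (mem_of_mem_erase hx)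
  have heg : e ∈ gr N := mem_of_mem_erase (mem_of_mem_erase he)
  have hug : u ∈ gr N := mem_of_mem_erase (mem_of_mem_erase huE)
  have hvg : v ∈ gr N := mem_of_mem_erase (mem_of_mem_erase hvE)
  obtain ⟨h3, h4⟩ := (typeI_mem_iff h hn he hx hf hxe hfe hfx he1 hx1 hex hu hv huv).1 (hWuv ▸ hW)
  rw [hWuv] at hoff ⊢
  rw [Q_sdiff_typeI_eq]
  set Z := (((((((gr N).erase b).erase b').erase e).erase x).erase f).erase u).erase v with hZ
  have hZQ : Z ⊆ (((((gr N).erase b).erase b').erase e).erase x).erase f := fun z hz =>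
    mem_of_mem_erase (mem_of_mem_erase hz)
  have hZE : Z ⊆ ((gr N).erase b).erase b' := fun z hz => (mem_Q_unpack (hZQ hz)).2.2.2
  have hfZ : f ∉ insert e Z := by
    simp only [mem_insert, not_or]
    exact ⟨hfe, fun h' => (mem_Q_unpack (hZQ h')).1 rfl⟩
  have heZ : e ∉ Z := fun h' => (mem_Q_unpack (hZQ h')).2.2.1 rfl
  have hZc : Z.card = 2 := by
    rw [hZ, card_erase_of_mem (mem_erase.2 ⟨huv.symm, hv⟩), card_erase_of_mem hu,
      card_erase_of_mem (mem_erase.2 ⟨hfx, mem_erase.2 ⟨hfe, hf⟩⟩), card_erase_of_mem (mem_erase.2 ⟨hxe, hx⟩),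
      card_erase_of_mem he, card_erase_of_mem (mem_erase.2 ⟨h.2.2.1.symm, h.2.1⟩), card_erase_of_mem h.1, hn]
  have hW'E : insert f (insert e Z) ⊆ ((gr N).erase b).erase b' := insert_subset hf (insert_subset he hZE)
  have hW'4 : (insert f (insert e Z)).card = 4 := by
    rw [card_insert_of_notMem hfZ, card_insert_of_notMem heZ, hZc]
  rw [mem_biIndepSets_iff_of_subset_E7 h hn hW'E hW'4, hZ, E7_sdiff_typeII_image_eq hx hxe hfx hu hv, insert_comm]
  refine ⟨h4, ?_⟩
  -- ρ({b, b′, x, u, v}) = ρ({b, b′, e, u, v}) = ρ(insert b′ W) = 5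
  rw [insert_bb'_triple_eq, rk_insert_eq_of_parallel' hxg heg hx1 he1 (by rw [pair_comm]; exact hex)
    (insert_subset hbg (insert_subset hb'g (insert_subset hug (singleton_subset_iff.2 hvg)))),
    ← insert_bb'_triple_eq, insert_comm]
  have h5 : rk N (insert b' (insert b ({e, u, v} : Finset α))) ≤ 5 := by
    have := rk_le_card' (M := N) (insert b' (insert b ({e, u, v} : Finset α)))
    have hc : (insert b' (insert b ({e, u, v} : Finset α))).card ≤ 5 := by
      refine (card_insert_le _ _).trans (Nat.succ_le_succ ((card_insert_le _ _).trans ?_))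
      exact Nat.succ_le_succ (card_triple_le_three e u v)
    omega
  omega

/-- A Type I set is recovered from its trace on `Q`: `insert b {e, u, v} = insert b (insert e (Q ∩ insert b {e, u, v}))`. -/
theorem typeI_eq_of_inter {b b' e x f u v : α}
    (hu : u ∈ (((((gr N).erase b).erase b').erase e).erase x).erase f)
    (hv : v ∈ (((((gr N).erase b).erase b').erase e).erase x).erase f) :
    insert b ({e, u, v} : Finset α) =
      insert b (insert e ((((((gr N).erase b).erase b').erase e).erase x).erase f ∩ insert b {e, u, v})) := by
  set Q := (((((gr N).erase b).erase b').erase e).erase x).erase f with hQ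
  ext z
  simp only [mem_insert, mem_singleton, mem_inter]
  constructor
  · rintro (rfl | rfl | rfl | rfl)
    · exact Or.inl rfl
    · exact Or.inr (Or.inl rfl)
    · exact Or.inr (Or.inr ⟨hu, Or.inr (Or.inr (Or.inl rfl))⟩)
    · exact Or.inr (Or.inr ⟨hv, Or.inr (Or.inr (Or.inr rfl))⟩)
  · rintro (rfl | rfl | ⟨-, h⟩)
    · exact Or.inl rfl
    · exact Or.inr (Or.inl rfl)
    · exact h

/-- **(B)**: `#(OFF Type I sets of the left family) ≤ #(Type II sets of the right family)`. -/
theorem card_typeI_off_le_card_typeII {b b' e x f : α} (h : SeriesPair N b b') (hn : (gr N).card = 9)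
    (he : e ∈ ((gr N).erase b).erase b') (hx : x ∈ ((gr N).erase b).erase b') (hf : f ∈ ((gr N).erase b).erase b')
    (hxe : x ≠ e) (hfe : f ≠ e) (hfx : f ≠ x) (he1 : rk N {e} = 1) (hx1 : rk N {x} = 1) (hex : rk N {e, x} = 1) :
    ((biIndepSets N 4).filter (fun W => (((e ∈ W ∧ f ∉ W) ∧ b' ∉ W) ∧ b ∈ W) ∧ ¬ rk N (insert b' W) ≤ 4)).card ≤
      ((biIndepSets N 4).filter (fun W => ((e ∈ W ∧ f ∈ W) ∧ b' ∉ W) ∧ b ∉ W)).card := by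
  have hb'f : b' ≠ f := fun h' => (mem_erase.1 hf).1 h'.symm
  have hb'e : b' ≠ e := fun h' => (mem_erase.1 he).1 h'.symm
  have hbf : b ≠ f := fun h' => (mem_erase.1 (mem_erase.1 hf).2).1 h'.symm
  have hbe : b ≠ e := fun h' => (mem_erase.1 (mem_erase.1 he).2).1 h'.symm
  apply card_le_card_of_injOn
    (fun W => insert f (insert e ((((((gr N).erase b).erase b').erase e).erase x).erase f \ W)))
  · intro W hW
    simp only [mem_coe, mem_filter] at hW ⊢
    obtain ⟨hW, ⟨⟨⟨heW, hfW⟩, hb'W⟩, hbW⟩, hoff⟩ := hW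
    obtain ⟨hbQ, -, -, hb'Q⟩ := not_mem_Q_sdiff (N := N) (b := b) (b' := b') (e := e) (x := x) (f := f) (W := W)
    refine ⟨typeI_off_image_mem h hn he hx hf hxe hfe hfx he1 hx1 hex hW heW hfW hb'W hbW hoff,
      ⟨⟨mem_insert_of_mem (mem_insert_self e _), mem_insert_self f _⟩, ?_⟩, ?_⟩
    · simp only [mem_insert, not_or]
      exact ⟨hb'f, hb'e, hb'Q⟩
    · simp only [mem_insert, not_or]
      exact ⟨hbf, hbe, hbQ⟩
  · intro W₁ hW₁ W₂ hW₂ heq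
    simp only [mem_coe, mem_filter] at hW₁ hW₂
    obtain ⟨hW₁, ⟨⟨⟨heW₁, hfW₁⟩, hb'W₁⟩, hbW₁⟩, -⟩ := hW₁
    obtain ⟨hW₂, ⟨⟨⟨heW₂, hfW₂⟩, hb'W₂⟩, hbW₂⟩, -⟩ := hW₂
    obtain ⟨-, hfQ₁, heQ₁, -⟩ := not_mem_Q_sdiff (N := N) (b := b) (b' := b') (e := e) (x := x) (f := f) (W := W₁)
    obtain ⟨-, hfQ₂, heQ₂, -⟩ := not_mem_Q_sdiff (N := N) (b := b) (b' := b') (e := e) (x := x) (f := f) (W := W₂)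
    have hsd : (((((gr N).erase b).erase b').erase e).erase x).erase f \ W₁ =
        (((((gr N).erase b).erase b').erase e).erase x).erase f \ W₂ := by
      have := congrArg (fun S => (S.erase f).erase e) heq
      simp only at this
      rwa [erase_insert (by simp only [mem_insert, not_or]; exact ⟨hfe, hfQ₁⟩), erase_insert heQ₁,
        erase_insert (by simp only [mem_insert, not_or]; exact ⟨hfe, hfQ₂⟩), erase_insert heQ₂] at this
    have hint : (((((gr N).erase b).erase b').erase e).erase x).erase f ∩ W₁ =
        (((((gr N).erase b).erase b').erase e).erase x).erase f ∩ W₂ := by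
      rw [← sdiff_sdiff_self_left, hsd, sdiff_sdiff_self_left]
    obtain ⟨u₁, v₁, hu₁, hv₁, -, hW₁e⟩ := typeI_structure h he hxe hex hW₁ heW₁ hfW₁ hb'W₁ hbW₁
    obtain ⟨u₂, v₂, hu₂, hv₂, -, hW₂e⟩ := typeI_structure h he hxe hex hW₂ heW₂ hfW₂ hb'W₂ hbW₂
    rw [hW₁e, typeI_eq_of_inter hu₁ hv₁, ← hW₁e, hint, hW₂e, ← typeI_eq_of_inter hu₂ hv₂]

end StarSharpD2

end PercRepro.Cogirth
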